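import Summits.CriticalPhenomena.SAWScalingLimit.Theses.SAWDefectDecoherence
import Summits.CriticalPhenomena.SAWScalingLimit.Theorems.HexObservableLimitR.Negative.FloorEdges

/-!
# Negative knowledge on crux `HexObservableLimitR` (stmt-CriticalPhenomena-14003), part 2:
a FULLY PINNED admissible instance of the repaired target on the half-disc

The repaired target `HexObservableLimitR` (Duminil-Copin–Smirnov 2012 Conjecture 2, `ψ`-averaged,
normalised at `b_δ`, with BOTH marked points pinned: flat half-plane piece of `∂Ω` and exact
half-lattice of `Λ_δ` inside `ball (pt i) ρ`) quantifies over a long list of hypotheses.  This file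
shows the list is SATISFIABLE, uniformly in a parameter `r ∈ (0, 3/8]`, by explicit data on the upper
half unit disc `HD`: discretisation `Lam δ false` (the strip-profile body of the landed corridor
refutation, the exact half-lattice `{row ≥ 0}` inside both pin-balls `ball 0 (1/8)`, `ball r (1/8)`),
root / normaliser the floor edges `bEdge → 0` and `vEdge (nC r δ) → r` (part 1), `ρ = 1/8`, both row
thresholds `0`.  Two packagings of the `∀`-body `Body c` of the target
(`body_iff : HexObservableLimitR ↔ ∃ c ≠ 0, Body c`):
`instance_limit_rootZero` — marks `(0, r)`, uniformiser `Ψ_r = PsiCE r` (`0 ↦ ∞`, `r ↦ 0`), logarithm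
`Mfun r`; `instance_limit_normZero` — marks `(r, 0)`, uniformiser `Φ_r = PhiCE r` (`r ↦ ∞`, `0 ↦ 0`),
logarithm `Lfun r`.  Consumers: `ConstUnique.lean` (the universal constant is unique — the target is not
provable by vacuity), `MarkedLimits.lean`, `LogBranch.lean`, `RadiusPos.lean` (load-bearing hypotheses).
Everything proved. [folklore]
-/

noncomputable section

open Set Filter Topology Complex
open Literature.Probability.RandomPlanarGeometry
open UpperHalfPlane (upperHalfPlaneSet)
open Literature.Probability.LatticeModels Literature.Probability.RandomPlanarGeometry.SAW

namespace Summit.CriticalPhenomena.SAWScalingLimit.Theorems.HexObservableLimitR.Negative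

open BoundaryClosure.Negative BoundaryClosureR.Negative
open Summit.CriticalPhenomena.SAWScalingLimit.Theses.SAWDefectDecoherence

/-! ### The `∀`-body of the target -/

/-- **The `∀`-body of `HexObservableLimitR` with universal constant `c`** (verbatim the text after
`∃ c : ℂ, c ≠ 0 ∧`). [folklore] -/
def Body (c : ℂ) : Prop :=
  ∀ (D : Literature.Probability.RandomPlanarGeometry.DobrushinDomain) (ρ : ℝ)
    (Λ : ℝ → Finset Literature.Probability.LatticeModels.HexVertex) (m : Fin 2 → ℝ → ℤ)
    (a b : ℝ → Sym2 Literature.Probability.LatticeModels.HexVertex)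
    (Φ : Literature.Probability.RandomPlanarGeometry.ConformalEquiv D.carrier UpperHalfPlane.upperHalfPlaneSet)
    (L : ℂ → ℂ) (Lb : ℂ) (ψ : ℂ → ℂ),
    let F : ℝ → Sym2 Literature.Probability.LatticeModels.HexVertex → ℂ := fun δ z =>
      Literature.Probability.RandomPlanarGeometry.SAW.hexParafermionicObservable (Λ δ) (a δ)
        Literature.Probability.RandomPlanarGeometry.SAW.hexCriticalFugacity (5 / 8) z
    0 < ρ → (∀ i : Fin 2, D.carrier ∩ Metric.ball (D.pt i) ρ = {z : ℂ | (D.pt i).im < z.im} ∩ Metric.ball (D.pt i) ρ) →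
    (∀ᶠ δ : ℝ in nhdsWithin 0 (Set.Ioi 0),
      Literature.Probability.RandomPlanarGeometry.SAW.hexDomainSimplyConnected (Λ δ) ∧
      a δ ∈ Literature.Probability.RandomPlanarGeometry.SAW.hexDomainBoundary (Λ δ) ∧
      b δ ∈ Literature.Probability.RandomPlanarGeometry.SAW.hexDomainBoundary (Λ δ) ∧
      Nonempty (Literature.Probability.RandomPlanarGeometry.SAW.HexMidEdgeSAW (Λ δ) (a δ) (b δ)) ∧
      (Literature.Probability.LatticeModels.hexGraph.induce ((Λ δ : Finset
        Literature.Probability.LatticeModels.HexVertex) : Set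
        Literature.Probability.LatticeModels.HexVertex)).Preconnected ∧
      (∀ v ∈ Λ δ, (δ : ℂ) * Literature.Probability.LatticeModels.hexCenter v ∈ D.carrier) ∧
      (∀ i : Fin 2, ∀ v : Literature.Probability.LatticeModels.HexVertex, (δ : ℂ) *
        Literature.Probability.LatticeModels.hexCenter v ∈ Metric.ball (D.pt i) ρ → (v ∈ Λ δ ↔ m i δ ≤ v.1 1))) →
    (∀ K : Set ℂ, IsCompact K → K ⊆ D.carrier → ∀ᶠ δ : ℝ in nhdsWithin 0 (Set.Ioi 0), ∀ v :
      Literature.Probability.LatticeModels.HexVertex, (δ : ℂ) *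
      Literature.Probability.LatticeModels.hexCenter v ∈ K → v ∈ Λ δ) →
    Filter.Tendsto (fun δ : ℝ => (δ : ℂ) * Literature.Probability.RandomPlanarGeometry.SAW.hexMidpoint (a δ))
      (nhdsWithin 0 (Set.Ioi 0)) (nhds (D.pt 0)) →
    Filter.Tendsto (fun δ : ℝ => (δ : ℂ) * Literature.Probability.RandomPlanarGeometry.SAW.hexMidpoint (b δ))
      (nhdsWithin 0 (Set.Ioi 0)) (nhds (D.pt 1)) →
    Filter.Tendsto (fun x => ‖Φ x‖) (nhdsWithin (D.pt 0) D.carrier) Filter.atTop →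
    Φ.HasBoundaryValue (D.pt 1) 0 → ContinuousOn L D.carrier → (∀ z ∈ D.carrier, Complex.exp (L z) = deriv Φ z) →
    Filter.Tendsto L (nhdsWithin (D.pt 1) D.carrier) (nhds Lb) → Continuous ψ → HasCompactSupport ψ →
    tsupport ψ ⊆ D.carrier →
    Filter.Tendsto (fun δ : ℝ => (δ : ℂ) ^ 2 * (∑ᶠ e ∈
      Literature.Probability.RandomPlanarGeometry.SAW.hexDomainMidEdges (Λ δ), ψ ((δ : ℂ) *
      Literature.Probability.RandomPlanarGeometry.SAW.hexMidpoint e) * F δ e) / F δ (b δ))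
      (nhdsWithin 0 (Set.Ioi 0)) (nhds (c * ∫ z, ψ z * Complex.exp ((5 / 8 : ℂ) * (L z - Lb))))

/-- The target is `∃ c ≠ 0, Body c` (definitional). [folklore] -/
theorem body_iff : HexObservableLimitR ↔ ∃ c : ℂ, c ≠ 0 ∧ Body c := Iff.rfl

/-! ### The two pinned instances -/

/-- **Pinned instance, root at `0`**: on the half-disc marked `(pt 0, pt 1) = (0, r)`, `0 < r ≤ 3/8`, the
body `Lam δ false` rooted at `bEdge → 0` and normalised at `vEdge (nC r δ) → r`, with `ρ = 1/8`, both row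
thresholds `0`, `Ψ_r : 0 ↦ ∞, r ↦ 0` and `M_r = log Ψ_r'`, satisfies EVERY hypothesis of the target; so
`Body c` yields the limit `c ∫ ψ e^{(5/8)(M_r - M_r r)}` of its normalised averages. [folklore] -/
theorem instance_limit_rootZero {c : ℂ} (H : Body c) {r : ℝ} (hr : 0 < r ∧ r ≤ 3 / 8)
    {ψ : ℂ → ℂ} (hψc : Continuous ψ) (hψK : HasCompactSupport ψ) (hψD : tsupport ψ ⊆ HD) :
    Filter.Tendsto (fun δ : ℝ => (δ : ℂ) ^ 2 * (∑ᶠ e ∈ hexDomainMidEdges (Lam δ false),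
        ψ ((δ : ℂ) * hexMidpoint e) * hexParafermionicObservable (Lam δ false) bEdge
          hexCriticalFugacity (5 / 8) e) /
        hexParafermionicObservable (Lam δ false) bEdge hexCriticalFugacity (5 / 8) (vEdge (nC r δ)))
      (nhdsWithin 0 (Set.Ioi 0))
      (nhds (c * ∫ z, ψ z * Complex.exp ((5 / 8 : ℂ) * (Mfun r z - Mfun r r)))) := by
  have hr1 : 0 < r ∧ r < 1 := ⟨hr.1, by linarith [hr.2]⟩
  have H' := H (halfDiscDomain' r hr1) (1 / 8) (fun δ => Lam δ false) (fun _ _ => 0) (fun _ => bEdge)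
    (fun δ => vEdge (nC r δ)) (PsiCE r hr1) (Mfun r) (Mfun r r) ψ
  simp only [pt_zero_halfDiscDomain', pt_one_halfDiscDomain', carrier_halfDiscDomain'] at H'
  refine H' (by norm_num) ?_ ?_ (exhaustion) tendsto_smul_midpoint_bEdge
    (tendsto_smul_midpoint_vEdge fun δ hδ => abs_nC r δ hδ) (tendsto_norm_PsiCE hr1) (tendsto_PsiCE_r hr1)
    (continuousOn_Mfun hr1) (fun z hz => exp_Mfun hr1 hz) (tendsto_Mfun_r hr1) hψc hψK hψD
  · -- flatness at both marked points
    refine Fin.forall_fin_two.2 ⟨?_, ?_⟩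
    · rw [pt_zero_halfDiscDomain']
      simpa using flat_at (p := 0) (by norm_num)
    · rw [pt_one_halfDiscDomain']
      exact flat_at (p := r) (by rw [abs_of_pos hr.1]; linarith [hr.2])
  · -- the discrete hypotheses, for `0 < δ ≤ min (1/16) r`
    filter_upwards [eventually_small hr.1] with δ hδ
    obtain ⟨hδ, hδ', hδr⟩ := hδ
    obtain ⟨h1, h2, h3, h4, -, h6, h7, h8⟩ := discrete_hyps hδ hδ' hr hδr
    refine ⟨h1, h2, h3, h4, h6, h7, Fin.forall_fin_two.2 ⟨fun v hv => ?_, fun v hv => ?_⟩⟩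
    · rw [pt_zero_halfDiscDomain'] at hv
      exact h8 0 (by norm_num) v (by simpa using hv)
    · rw [pt_one_halfDiscDomain'] at hv
      exact h8 r (by rw [abs_of_pos hr.1]; linarith [hr.2]) v hv

/-- **Pinned instance, normaliser at `0`**: on the half-disc marked `(pt 0, pt 1) = (r, 0)`, `0 < r ≤ 3/8`,
the body rooted at `vEdge (nC r δ) → r` and normalised at `bEdge → 0`, with `ρ = 1/8`, both row
thresholds `0`, `Φ_r : r ↦ ∞, 0 ↦ 0` and `L_r = log Φ_r'`, satisfies every hypothesis of the target; so
`Body c` yields the limit `c ∫ ψ e^{(5/8)(L_r - L_r 0)}`. [folklore] -/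
theorem instance_limit_normZero {c : ℂ} (H : Body c) {r : ℝ} (hr : 0 < r ∧ r ≤ 3 / 8)
    {ψ : ℂ → ℂ} (hψc : Continuous ψ) (hψK : HasCompactSupport ψ) (hψD : tsupport ψ ⊆ HD) :
    Filter.Tendsto (fun δ : ℝ => (δ : ℂ) ^ 2 * (∑ᶠ e ∈ hexDomainMidEdges (Lam δ false),
        ψ ((δ : ℂ) * hexMidpoint e) * hexParafermionicObservable (Lam δ false) (vEdge (nC r δ))
          hexCriticalFugacity (5 / 8) e) /
        hexParafermionicObservable (Lam δ false) (vEdge (nC r δ)) hexCriticalFugacity (5 / 8) bEdge)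
      (nhdsWithin 0 (Set.Ioi 0))
      (nhds (c * ∫ z, ψ z * Complex.exp ((5 / 8 : ℂ) * (Lfun r z - Lfun r 0)))) := by
  have hr1 : 0 < r ∧ r < 1 := ⟨hr.1, by linarith [hr.2]⟩
  have H' := H (halfDiscDomain r hr1) (1 / 8) (fun δ => Lam δ false) (fun _ _ => 0)
    (fun δ => vEdge (nC r δ)) (fun _ => bEdge) (PhiCE r hr1) (Lfun r) (Lfun r 0) ψ
  simp only [pt_zero_halfDiscDomain, pt_one_halfDiscDomain] at H'
  refine H' (by norm_num) ?_ ?_ (exhaustion) (tendsto_smul_midpoint_vEdge fun δ hδ => abs_nC r δ hδ)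
    tendsto_smul_midpoint_bEdge (tendsto_norm_PhiCE hr1) (tendsto_PhiCE_zero hr1)
    (continuousOn_Lfun hr1) (fun z hz => exp_Lfun hr1 hz) (tendsto_Lfun_zero hr1) hψc hψK hψD
  · -- flatness at both marked points
    refine Fin.forall_fin_two.2 ⟨?_, ?_⟩
    · rw [pt_zero_halfDiscDomain]
      exact flat_at (p := r) (by rw [abs_of_pos hr.1]; linarith [hr.2])
    · rw [pt_one_halfDiscDomain]
      show HD ∩ _ = _
      simpa using flat_at (p := 0) (by norm_num)
  · -- the discrete hypotheses, for `0 < δ ≤ min (1/16) r`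
    filter_upwards [eventually_small hr.1] with δ hδ
    obtain ⟨hδ, hδ', hδr⟩ := hδ
    obtain ⟨h1, h2, h3, -, h5, h6, h7, h8⟩ := discrete_hyps hδ hδ' hr hδr
    refine ⟨h1, h3, h2, h5, h6, h7, Fin.forall_fin_two.2 ⟨fun v hv => ?_, fun v hv => ?_⟩⟩
    · rw [pt_zero_halfDiscDomain] at hv
      exact h8 r (by rw [abs_of_pos hr.1]; linarith [hr.2]) v hv
    · rw [pt_one_halfDiscDomain] at hv
      exact h8 0 (by norm_num) v (by simpa using hv)

end Summit.CriticalPhenomena.SAWScalingLimit.Theorems.HexObservableLimitR.Negative
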